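import Summits.BirchSwinnertonDyer.Rank1Residual.X2.GreenbergVatsalStrictSelmer
import Literature.NumberTheory.EllipticCurves.Greenberg1999.KummerImageGoodOrdinaryNumberField
import Literature.NumberTheory.EllipticCurves.TateCurve.NumberFieldUniformizationTwistedKernelOfReduction
import Literature.NumberTheory.EllipticCurves.SubgroupSelmerCocycleCriteriaProofs
import Literature.NumberTheory.GaloisRepresentations.DiscreteValuationDivisibleUnits
import HarnessLib

/-!
# KS(v) at ANY multiplicative place `v ∣ p`, `p` odd: `Im κ ⊆ Im λ` for Greenberg's
# `C_v = E[p^∞] ∩ E₁(K̄_v)` — the local inclusion `localKerOver ≤ strictKer` of the kernel-of-reduction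
# datum, PROVED (split and NON-split; Greenberg LNM 1716 §2 p. 76 «If `E` has nonsplit, multiplicative
# reduction, then the above assertion still holds for `p` odd»)

LEAD `bsd-wall-utd-p1` (g26), crux r205 stmt-BirchSwinnertonDyer-24737
`UniversalToricDescent.TwinAlgMuZeroAtThree`, line `beta-road` v10, K2 stub `stub_howardOutputsOfFamily`,
residue item (c) «readout/LINK at `v ∣ 3`»: the hypothesis `hKS` of the twin's readout
`ZpExtensionEisensteinReadoutOrdinaryLocalKummerStrictMultiplicativeThreeProofs` (p760847), discharged at
EVERY multiplicative `v ∣ p`, `p` odd (any number field `K : Type`, any subgroup `H ≤ Γ_K`); the split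
case alone is `…UniversalToricDescentKummerStrictSplitMultiplicative` (p763027, all `p`).

Proof. By `TateCurve.exists_twistedTateUniformisation_localKernelOfReduction` (Silverman ATAEC
V.5.2 (c)/V.5.3/V.3.1 PLUS §V.4's `Ψ(1 + 𝔪) ⊆ E₁(K̄_v)`, proved): `E(K̄_v) = Ψ(K̄_vˣ)`, `ker Ψ = q^ℤ`,
`σ • Ψ(u) = χ(σ) Ψ(σu)` with `χ(σ) = ±1` the sign of `σ` on `t = √γ(W)`. Let `c = [f]` be Kummer at the
place above `v`: `f(x) = σ_x P − P` on `H ⊓ D_v` (`P = Ψ(u)`). For `x` in the subgroup `A` of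
`H ⊓ D_v` FIXING `√γ` (index `≤ 2`), `f(x) = Ψ(σu/u)` is a `p`-power torsion point, so `σu/u` is a
`p`-power root of unity, a principal unit at residue characteristic `p`, whence `f(x) ∈ E₁ ∩ E[p^∞] = C_v`:
the reduced cocycle `ḡ : H ⊓ D_v → E[p^∞]/C_v` VANISHES on `A`. If `A` is everything we are done;
otherwise pick `τ ∉ A`, put `n = ḡ(τ)`; the cocycle identities give `a • n = n` (`a ∈ A`), `τ • n = −n`,
`ḡ(aτ) = n`, and since `E[p^∞]/C_v` is `p`-primary with `p` ODD, `n = −2m̄` for `m̄ = −((p^k+1)/2) n`,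
and `ḡ = ∂m̄` — i.e. the inflation–restriction step `H¹(ℤ/2, (E[p^∞]/C_v)^A) = 0` done by hand.

* `mem_localKernelOfReduction_of_unit_of_pow` — the unit lemma: `|ζ| = 1`, `Ψ(ζ^{p^k}) = 0 ⟹ Ψ(ζ) ∈ E₁(K̄_v)`;
* **`localKerOver_le_strictKer_kernelOfReduction_of_hasMultiplicativeReductionAt`** — KS(v), `p` odd.

BSD is proved for no curve by any of this; 24737 stays OPEN.
-/

set_option autoImplicit false
-- the summit and its single problem are both named `BirchSwinnertonDyer` (registry layout D-0017)
set_option linter.dupNamespace false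

noncomputable section

open scoped Classical NNReal

namespace Summit.BirchSwinnertonDyer.BirchSwinnertonDyer.Theorems.UniversalToricDescentKummerStrictMultiplicative

open NumberField IsDedekindDomain Field WeierstrassCurve
open Literature.NumberTheory.EllipticCurves Literature.NumberTheory.EllipticCurves.GreenbergSelmer
  Literature.NumberTheory.GaloisRepresentations IsDedekindDomain.HeightOneSpectrum
  Literature.NumberTheory.EllipticCurves.TateCurve Literature.NumberTheory.EllipticCurves.CocycleCriteria
  Summit.BirchSwinnertonDyer.Rank1Residual.X2

variable {K : Type} [Field K] [NumberField K] (W : WeierstrassCurve K) [W.IsElliptic]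
  (p : ℕ) [hp : Fact p.Prime] {v : HeightOneSpectrum (𝓞 K)}

omit [W.IsElliptic] in
/-- **The unit lemma.** For a homomorphism `Ψ : K̄_vˣ → E(K̄_v)` with kernel `q^ℤ` (`0 < |q|_v < 1`)
sending principal units into `E₁(K̄_v)`, at a place `v ∣ p`: a unit `ζ` (`|ζ|_v = 1`) with
`Ψ(ζ^{p^k}) = 0` has `Ψ(ζ) ∈ E₁(K̄_v)` — `ζ^{p^k} ∈ q^ℤ ∩ 𝒪^× = {1}`, and a `p`-power root of unity is a
principal unit at residue characteristic `p` (tree `valuation_sub_one_lt_one_of_pow_prime_pow`).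
[cite: GreenbergLNM1716, §2 p. 76] [cite: SerreLocalFields1979, Ch. IV §4 Prop. 17] -/
theorem mem_localKernelOfReduction_of_unit_of_pow (hpv : ((p : ℕ) : 𝓞 K) ∈ v.asIdeal)
    {q : v.adicCompletion K} (hq0 : q ≠ 0) (hq1 : Valued.v q < 1)
    (Ψ : Additive (AlgebraicClosure (v.adicCompletion K))ˣ →+ localPoints W (v.adicCompletion K))
    (hker : ∀ u : (AlgebraicClosure (v.adicCompletion K))ˣ, Ψ (Additive.ofMul u) = 0 ↔
      ∃ n : ℤ, (u : AlgebraicClosure (v.adicCompletion K)) =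
        algebraMap (v.adicCompletion K) (AlgebraicClosure (v.adicCompletion K)) q ^ n)
    (hred : ∀ u : (AlgebraicClosure (v.adicCompletion K))ˣ,
      v.spectralValuation ((u : AlgebraicClosure (v.adicCompletion K)) - 1) < 1 →
      Ψ (Additive.ofMul u) ∈ W.localKernelOfReduction v)
    (ζ : (AlgebraicClosure (v.adicCompletion K))ˣ) (k : ℕ)
    (hζ : v.spectralValuation (ζ : AlgebraicClosure (v.adicCompletion K)) = 1)
    (h0 : Ψ (Additive.ofMul (ζ ^ p ^ k)) = 0) :
    Ψ (Additive.ofMul ζ) ∈ W.localKernelOfReduction v := by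
  set L := AlgebraicClosure (v.adicCompletion K) with hL
  have hw := coe_spectralValuation v
  set w := v.spectralValuation with hw_def
  obtain ⟨a, ha⟩ := (hker _).1 h0
  have hq' : algebraMap (v.adicCompletion K) L q ≠ 0 :=
    (map_ne_zero_iff _ (algebraMap (v.adicCompletion K) L).injective).2 hq0
  have hwq0 : 0 < w (algebraMap (v.adicCompletion K) L q) := zero_lt_iff.2 ((map_ne_zero w).2 hq')
  have hwq : w (algebraMap (v.adicCompletion K) L q) < 1 := by
    rw [← NNReal.coe_lt_coe, coe_spectralValuation_algebraMap hw, NNReal.coe_one]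
    exact Valued.toNormedField.norm_lt_one_iff.mpr hq1
  have hpow : w (algebraMap (v.adicCompletion K) L q) ^ a =
      w (algebraMap (v.adicCompletion K) L q) ^ (0 : ℤ) := by
    rw [zpow_zero, ← map_zpow₀, ← ha, Units.val_pow_eq_pow_val, map_pow, hζ, one_pow]
  have ha0 : a = 0 := (zpow_right_strictAnti₀ hwq0 hwq).injective hpow
  rw [ha0, zpow_zero, Units.val_pow_eq_pow_val] at ha
  have hpmem : ((p : ℕ) : v.adicCompletionIntegers K) ∈
      IsLocalRing.maximalIdeal (v.adicCompletionIntegers K) := by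
    have h := (algebraMap_mem_maximalIdeal_adicCompletionIntegers_iff (v := v) ((p : ℕ) : 𝓞 K)).mpr hpv
    simpa only [map_natCast] using h
  have hvp : w ((p : ℕ) : L) < 1 := by
    have hcoe : (((p : ℕ) : v.adicCompletionIntegers K) : v.adicCompletion K) =
        (p : v.adicCompletion K) := by
      norm_cast
    have e : ((p : ℕ) : L) = algebraMap (v.adicCompletion K) L
        (((p : ℕ) : v.adicCompletionIntegers K) : v.adicCompletion K) := by
      rw [hcoe, map_natCast]
    rw [e, ← NNReal.coe_lt_coe, coe_spectralValuation_algebraMap hw, NNReal.coe_one,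
      Valued.toNormedField.norm_lt_one_iff]
    exact mem_maximalIdeal_adicCompletionIntegers_iff.mp hpmem
  have hζ1 : w ((ζ : L) - 1) < 1 :=
    valuation_sub_one_lt_one_of_pow_prime_pow w hvp hζ.le k
      (by rw [ha, sub_self, map_zero]; exact zero_lt_one)
  exact hred ζ hζ1

/-- **KS(v) at a multiplicative `v ∣ p`, `p` odd — `Im κ ⊆ Im λ` for `C_v = E[p^∞] ∩ E₁(K̄_v)`, PROVED
(split AND non-split)**: for every subgroup `H ≤ Γ_K`, the classes of `H¹(H, E[p^∞])` that are KUMMER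
at the place above `v` (`W.localKerOver p H K_v`) satisfy the STRICT condition there for the
kernel-of-reduction datum (`(W.kernelOfReductionLocalDatum p v).strictKer H`). This is the hypothesis
`hKS` of x9's readout `…exists_grMk_eq_coboundary_of_localKerOver_le_strictKer` and of the twin's
`…MultiplicativeThreeProofs` version (p760847), at every multiplicative place above an odd `p`.
[cite: GreenbergLNM1716, §2 pp. 75–76] [cite: SilvermanATAEC1994, Lemma V.5.2 (c), Thm. V.5.3, §V.4]
[cite: SerreGaloisCohomology1997, I §2.6 (b) (inflation–restriction)] -/
theorem localKerOver_le_strictKer_kernelOfReduction_of_hasMultiplicativeReductionAt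
    (hp2 : p ≠ 2) (hpv : ((p : ℕ) : 𝓞 K) ∈ v.asIdeal) (hmult : W.HasMultiplicativeReductionAt v)
    (H : Subgroup (absoluteGaloisGroup K)) :
    W.localKerOver p H (v.adicCompletion K) ≤ (W.kernelOfReductionLocalDatum p v).strictKer H := by
  set L := AlgebraicClosure (v.adicCompletion K) with hL
  set N := W.kernelOfReductionLocalDatum p v with hN
  obtain ⟨q, t, Ψ, hq0, hq1, ht0, ht, hsurj, hker, hΨσ, hred⟩ :=
    exists_twistedTateUniformisation_localKernelOfReduction W v hmult
  have hw := coe_spectralValuation v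
  -- characteristic `0` bookkeeping
  haveI := charZero_adicCompletion' K v
  haveI : CharZero L :=
    charZero_of_injective_algebraMap (algebraMap (v.adicCompletion K) L).injective
  haveI : CharZero (AlgebraicClosure K) :=
    charZero_of_injective_algebraMap (algebraMap K (AlgebraicClosure K)).injective
  -- a square root `t₀ ∈ K̄` of `γ(W) = -c₄/c₆`; its image in `K̄_v` is `± t`
  obtain ⟨t₀, ht₀⟩ := IsAlgClosed.exists_pow_nat_eq
    (algebraMap K (AlgebraicClosure K) (-(W.c₄ / W.c₆))) two_pos
  set ι := absClosureEmbedding K (v.adicCompletion K) with hι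
  have hιt₀sq : (ι t₀) ^ 2 = t ^ 2 := by
    rw [← map_pow, ht₀, ht, AlgHom.commutes, IsScalarTower.algebraMap_apply K (v.adicCompletion K) L]
  have hιt₀ : ι t₀ = t ∨ ι t₀ = -t := sq_eq_sq_iff_eq_or_eq_neg.mp hιt₀sq
  -- every `g ∈ Γ_K` acts on `t₀` by a sign
  have hpm : ∀ g : absoluteGaloisGroup K, g • t₀ = t₀ ∨ g • t₀ = -t₀ := by
    intro g
    apply sq_eq_sq_iff_eq_or_eq_neg.mp
    rw [← smul_pow', ht₀, Field.absoluteGaloisGroup.smul_def, AlgEquiv.commutes]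
  have hneg : ∀ g : absoluteGaloisGroup K, g • (-t₀) = -(g • t₀) := fun g ↦ smul_neg g t₀
  -- the sign dictionary: `σ t = t ↔ res σ • t₀ = t₀`
  have hsign : ∀ σ : absoluteGaloisGroup (v.adicCompletion K),
      Field.absoluteGaloisGroup.toAlgEquiv (v.adicCompletion K) σ t = t ↔
        absGaloisRestrict K (v.adicCompletion K) σ • t₀ = t₀ := by
    intro σ
    have key : σ • ι t₀ = ι (absGaloisRestrict K (v.adicCompletion K) σ • t₀) :=
      (absGaloisRestrict_apply_smul K (v.adicCompletion K) σ t₀).symm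
    rw [← Field.absoluteGaloisGroup.smul_def]
    constructor
    · intro h
      apply ι.toRingHom.injective
      change ι _ = ι t₀
      rw [← key]
      rcases hιt₀ with h' | h'
      · rw [h', h]
      · rw [h', smul_neg, h]
    · intro h
      rw [h] at key
      rcases hιt₀ with h' | h'
      · rw [← h', key]
      · have e : t = -ι t₀ := by rw [h', neg_neg]
        rw [e, smul_neg, key]
  -- the class
  intro c hc
  obtain ⟨f, rfl⟩ := oneCocycleClass_surjective (discreteTopRep H (W.geomPrimaryTorsion p)) c
  obtain ⟨P, hP⟩ := (GreenbergVatsalSelmerLink.oneCocycleClass_mem_localKerOver_iff W p H _ f).1 hc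
  obtain ⟨u, rfl⟩ := hsurj P
  obtain ⟨u', rfl⟩ : ∃ u' : Lˣ, Additive.ofMul u' = u := ⟨Additive.toMul u, ofMul_toMul u⟩
  rw [LocalDatum.mem_strictKer_iff, LocalDatum.strictMap, resH1Hom_oneCocycleClass_eq_zero_iff]
  -- the reduced cocycle `ḡ : H ⊓ D_v → E[p^∞]/C_v`
  set g : decompIn H v → N.Gr := fun x ↦ N.grMk (f.1 (decompInToH H v x)) with hg
  change ∃ n : N.Gr, ∀ x : decompIn H v, g x = x • n - n
  have hgmul : ∀ x y : decompIn H v, g (x * y) = g x + x • g y := by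
    intro x y
    have h2 := f.2 (decompInToH H v x) (decompInToH H v y)
    change f.1 (decompInToH H v x * decompInToH H v y) =
      f.1 (decompInToH H v x) + decompInToH H v x • f.1 (decompInToH H v y) at h2
    simp only [hg]
    rw [map_mul, h2, map_add]
    rfl
  -- `ḡ` vanishes on the subgroup fixing `√γ`
  have hA : ∀ x : decompIn H v,
      ((x : decomp (K := K) v) : absoluteGaloisGroup K) • t₀ = t₀ → g x = 0 := by
    intro x hx
    have hxH : ((x : decomp (K := K) v) : absoluteGaloisGroup K) ∈ H := (mem_decompIn_iff H v _).1 x.2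
    obtain ⟨σ, hσx⟩ := (mem_decomp_iff v ((x : decomp (K := K) v) : absoluteGaloisGroup K)).1 x.1.2
    have hσH : σ ∈ localSubgroup H (v.adicCompletion K) :=
      GreenbergVatsalSelmerLink.mem_localSubgroup_of_absGaloisRestrict_mem H (by rw [hσx]; exact hxH)
    have hres : resGalSubgroup H (v.adicCompletion K) ⟨σ, hσH⟩ = decompInToH H v x := Subtype.ext hσx
    have key := hP ⟨σ, hσH⟩
    rw [hres] at key
    -- `σ` fixes `t`, so `σ • Ψ(u') = Ψ(σ u')` and `f(x) = Ψ(σu'/u')`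
    have hσt : Field.absoluteGaloisGroup.toAlgEquiv (v.adicCompletion K) σ t = t :=
      (hsign σ).mpr (by rw [hσx]; exact hx)
    have hΨ := hΨσ σ u'
    rw [if_pos hσt, one_zsmul] at hΨ
    set ζ : Lˣ := Units.map (Field.absoluteGaloisGroup.toAlgEquiv (v.adicCompletion K) σ : L →* L) u' * u'⁻¹
      with hζdef
    have hζΨ : Ψ (Additive.ofMul ζ) = pointsMap W (v.adicCompletion K)
        ((f.1 (decompInToH H v x) : W.geomPrimaryTorsion p) : W.geomPoints) := by
      rw [key, hζdef, ofMul_mul, ofMul_inv, map_add, map_neg, ← hΨ, sub_eq_add_neg]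
    obtain ⟨k, hk⟩ := (AddCommGroup.mem_primaryComponent).1 (f.1 (decompInToH H v x)).2
    have h0 : Ψ (Additive.ofMul (ζ ^ p ^ k)) = 0 := by
      rw [ofMul_pow, map_nsmul, hζΨ, ← map_nsmul, hk, map_zero]
    have hu0 : v.spectralValuation (u' : L) ≠ 0 := (map_ne_zero _).2 u'.ne_zero
    have hwζ : v.spectralValuation (ζ : L) = 1 := by
      rw [hζdef, Units.val_mul, map_mul, Units.coe_map, MonoidHom.coe_coe,
        ← Field.absoluteGaloisGroup.smul_def, spectralValuation_smul hw, Units.val_inv_eq_inv_val,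
        map_inv₀, mul_inv_cancel₀ hu0]
    have hmem := mem_localKernelOfReduction_of_unit_of_pow W p hpv hq0 hq1 Ψ hker hred ζ k hwζ h0
    rw [hζΨ, ← WeierstrassCurve.mem_kernelOfReductionLocalDatum_plus_iff] at hmem
    change f.1 (decompInToH H v x) ∈ N.plus at hmem
    rw [← N.ker_grMk, AddMonoidHom.mem_ker] at hmem
    exact hmem
  -- case 1: everybody in `H ⊓ D_v` fixes `√γ`
  by_cases hall : ∀ x : decompIn H v, ((x : decomp (K := K) v) : absoluteGaloisGroup K) • t₀ = t₀
  · exact ⟨0, fun x ↦ by rw [smul_zero, sub_zero]; exact hA x (hall x)⟩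
  -- case 2: some `τ ∈ H ⊓ D_v` flips `√γ`
  push Not at hall
  obtain ⟨τ, hτ⟩ := hall
  have hτ' : ((τ : decomp (K := K) v) : absoluteGaloisGroup K) • t₀ = -t₀ :=
    (hpm _).resolve_left hτ
  -- coercions of products and inverses in `decompIn H v`
  have hcoe_mul : ∀ x y : decompIn H v,
      (((x * y : decompIn H v) : decomp (K := K) v) : absoluteGaloisGroup K) =
        ((x : decomp (K := K) v) : absoluteGaloisGroup K) *
          ((y : decomp (K := K) v) : absoluteGaloisGroup K) :=
    fun _ _ ↦ rfl
  have hcoe_inv : ∀ x : decompIn H v,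
      (((x⁻¹ : decompIn H v) : decomp (K := K) v) : absoluteGaloisGroup K) =
        (((x : decomp (K := K) v) : absoluteGaloisGroup K))⁻¹ :=
    fun _ ↦ rfl
  -- `τ⁻¹` flips, `τ⁻¹ a τ` and `τ τ` fix, `x τ⁻¹` fixes when `x` flips
  have hτinv : (((τ⁻¹ : decompIn H v) : decomp (K := K) v) : absoluteGaloisGroup K) • t₀ = -t₀ := by
    rw [hcoe_inv]
    have h := congrArg ((((τ : decomp (K := K) v) : absoluteGaloisGroup K))⁻¹ • ·) hτ'
    simp only [inv_smul_smul, smul_neg] at h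
    have h' := congrArg Neg.neg h
    rw [neg_neg] at h'
    exact h'.symm
  have hfix_of_flip : ∀ x : decompIn H v,
      ((x : decomp (K := K) v) : absoluteGaloisGroup K) • t₀ = -t₀ →
        (((x * τ⁻¹ : decompIn H v) : decomp (K := K) v) : absoluteGaloisGroup K) • t₀ = t₀ := by
    intro x hx
    rw [hcoe_mul, mul_smul, hτinv, hneg, hx, neg_neg]
  have hconj : ∀ a : decompIn H v,
      ((a : decomp (K := K) v) : absoluteGaloisGroup K) • t₀ = t₀ →
        (((τ⁻¹ * a * τ : decompIn H v) : decomp (K := K) v) : absoluteGaloisGroup K) • t₀ = t₀ := by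
    intro a ha
    rw [hcoe_mul, hcoe_mul, mul_smul, mul_smul, hτ', hneg, ha, hneg, hτinv, neg_neg]
  have hττ : (((τ * τ : decompIn H v) : decomp (K := K) v) : absoluteGaloisGroup K) • t₀ = t₀ := by
    rw [hcoe_mul, mul_smul, hτ', hneg, hτ', neg_neg]
  -- `n = ḡ(τ)`: `τ • n = -n`; `a • n = n` and `ḡ(a τ) = n` for `a` fixing `√γ`
  set n : N.Gr := g τ with hn
  have hτn : τ • n = -n := by
    have h := hgmul τ τ
    rw [hA _ hττ] at h
    exact (add_eq_zero_iff_neg_eq.mp h.symm).symm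
  have haτ : ∀ a : decompIn H v,
      ((a : decomp (K := K) v) : absoluteGaloisGroup K) • t₀ = t₀ → g (a * τ) = n ∧ a • n = n := by
    intro a ha
    have h1 := hgmul a τ
    rw [hA a ha, zero_add] at h1
    have h2 := hgmul τ (τ⁻¹ * a * τ)
    rw [hA _ (hconj a ha), smul_zero, add_zero,
      show τ * (τ⁻¹ * a * τ) = a * τ by group] at h2
    exact ⟨h2, by rw [← h1, h2]⟩
  -- `n` is `p`-power torsion and `p` is odd: `n = -2 m̄` with `m̄ = -((p^k + 1)/2) • n`
  obtain ⟨k, hk⟩ := (AddCommGroup.mem_primaryComponent).1 (f.1 (decompInToH H v τ)).2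
  have hkn : p ^ k • n = 0 := by
    have hm : p ^ k • (f.1 (decompInToH H v τ) : W.geomPrimaryTorsion p) = 0 :=
      Subtype.ext (by rw [AddSubmonoidClass.coe_nsmul, hk]; rfl)
    change p ^ k • N.grMk (f.1 (decompInToH H v τ)) = 0
    rw [← map_nsmul, hm, map_zero]
  have hodd : Odd (p ^ k) := (hp.out.eq_two_or_odd'.resolve_left hp2).pow
  obtain ⟨c, hc⟩ := hodd.add_one
  -- `hc : p ^ k + 1 = c + c`
  have hsmul_comm : ∀ (y : decompIn H v) (j : ℕ) (z : N.Gr), y • (j • z) = j • (y • z) :=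
    fun y j z ↦ map_nsmul (DistribSMul.toAddMonoidHom N.Gr y) j z
  have h2c : c • n + c • n = n := by
    rw [← add_nsmul, ← hc, add_nsmul, hkn, zero_add, one_nsmul]
  refine ⟨-(c • n), fun x ↦ ?_⟩
  rcases hpm ((x : decomp (K := K) v) : absoluteGaloisGroup K) with hx | hx
  · -- `x` fixes `√γ`: `ḡ(x) = 0` and `x • n = n`
    rw [hA x hx, smul_neg, hsmul_comm, (haτ x hx).2, sub_self]
  · -- `x` flips `√γ`: `x = a τ` with `a = x τ⁻¹` fixing
    have ha := hfix_of_flip x hx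
    have hx' : x = x * τ⁻¹ * τ := by rw [inv_mul_cancel_right]
    obtain ⟨hgx, han⟩ := haτ (x * τ⁻¹) ha
    rw [hx', hgx, mul_smul, smul_neg, smul_neg, hsmul_comm τ, hτn, smul_neg, smul_neg, neg_neg,
      hsmul_comm, han, sub_neg_eq_add, h2c]

end Summit.BirchSwinnertonDyer.BirchSwinnertonDyer.Theorems.UniversalToricDescentKummerStrictMultiplicative

end
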